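import Literature.MathematicalPhysics.QuantumFieldTheory.Balaban1983to89.Node00.Record8Inhabited
import Literature.MathematicalPhysics.QuantumFieldTheory.Balaban1983to89.B10Eq18SigmaSU2
import Literature.MathematicalPhysics.QuantumFieldTheory.ConstructiveQFTBalabanRG

/-!
# NODE 00 (YM-PLAN Track A) — STAGE 8, THE CHART CLAUSE OF RECORD: `Stage8Params.IsChartOfRecord θ c` («the β-layer's chart `(Vβ, ρ8, bV)`
# IS the Lie algebra 𝔰𝔲(N) ↪ M_N(ℂ) with a Hilbert–Schmidt-orthogonal basis of squared norm `c`»), the amended record predicate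
# `IsRecordOfRecord₈X` (= `IsRecordOfRecord₈C` ∧ the chart clause, `0 < c`), its refinement to ₈C, what the clause EXCLUDES
# (the zero chart, for `N ≥ 2`) and what it does NOT (at `N = 1`, 𝔰𝔲(1) = 0: the chart of record IS the zero chart), and inhabitants
# WITH A GENUINE CHART: print's Pauli coordinates `A ↦ iΣσ_aA^a` at `N = 2` (`c = 2`), and an `hsForm`-orthonormal basis of 𝔰𝔲(N) for every `N` (`c = 1`)

NODE 00 STAGE-8 AMENDMENT MODULE (seat `pub-ymgap-dag-n23-b` g2, 2026-08-26; HUMAN RULING D-0062).  APPEND-ONLY GROWTH: a NEW importing module; no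
landed module is edited; the Stage-9 owner (node00-def successor, `Record9.Admissible`) may conjoin `IsChartOfRecord` or ignore this file.  WHY: the
Stage-8 β of record `Record8.betaOfRecord₈ θ` is a FUNCTION of the chart `(θ.Vβ, θ.ρ8, θ.bV)` along which the Hessian (1.20) is read, and
`Stage8Params.Admissible` puts no clause on it; at `ρ8 = 0` the β of record is identically zero (`Record8Inhabited.betaOfRecord₈_of_zeroChart`), so
every `∃`-face over `IsRecordOfRecord₈C` reading only the flow is junk-satisfiable (pub-ymgap: dag-ref-D control rule ZEROCHART v0.33, director-ym LINE №31,
chair R445 (a2)∕(a5): «countable shapes … a DISPLAYED non-degenerate chart instance of record (su(N) ↪ M_N(ℂ), ρ8 = inclusion, bV trace-orthonormal) …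
or any form stated AFTER a chart clause of record has entered admissibility»).  THIS FILE TYPES THAT CLAUSE.
PRINT: [Balaban1987RG1] p. 264, before (1.20): *«𝐄^{(j+1)}(g_j, B) = 𝐄^{(j+1)}(g_j, U_{j+1}(exp iB))»* with `B` in the Lie algebra of `G ⊂ U(N)`
(p. 251 «for example G ⊂ U(N)»), differentiated in the colour components `B^a` of an orthonormal basis ((1.21)₁: `Π^{ab} = δ^{ab} Π`); for `G = SU(N)`
the Lie algebra is 𝔰𝔲(N) = the traceless skew-Hermitian matrices (`Literature.Algebra.Lie.CompactKillingForm.su`, `mem_su_iff`; here stated ELEMENTWISE,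
`Xᴴ = −X ∧ Tr X = 0`, so that no Lie-ring instance on `M_N(ℂ)` is needed) with the Hilbert–Schmidt form `hsForm n X Y = Re Tr(XᴴY)`.

* §1 `IsSuChart N ρ b c` (on RAW chart data `ρ : V →L[ℝ] M_N(ℂ)`, `b` a basis of `V`) := (i) every chart value `ρ v` is traceless skew-Hermitian;
  (ii) every traceless skew-Hermitian matrix is a chart value; (iii)∕(iv) the basis read through the chart is `hsForm`-orthogonal with squared norms `c`
  (print's normalisation constant — DISPLAYED; the record asks `0 < c`); `Stage8Params.IsChartOfRecord θ c := IsSuChart N θ.ρ8 θ.bV c`.  Consequences: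
  `IsSuChart.apply_basis_ne_zero`, `IsSuChart.ne_zero_of_nonempty`; for `2 ≤ N`: `exists_tracelessSkewHermitian_ne_zero` (the matrix `diag(i, −i, 0, …)`),
  `IsSuChart.nonempty_index_of_two_le`, `IsSuChart.ne_zero_of_two_le` and **`Stage8Params.IsChartOfRecord.rho8_ne_zero`** — THE ZERO CHART IS EXCLUDED, so
  `Record8Inhabited.betaOfRecord₈_of_zeroChart` cannot fire at a chart of record; for `N = 1`: `eq_zero_of_traceless_one` (𝔰𝔲(1) = 0),
  `IsSuChart.eq_zero_of_one`, `Stage8Params.IsChartOfRecord.rho8_eq_zero_of_one`, **`….betaOfRecord₈_eq_zeroHBeta_of_one`** — at `N = 1` the chart of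
  record IS the zero chart and the β of record vanishes GENUINELY (a Thm-2 ∕ (0.31) clause over the record needs `2 ≤ N`; the route's cruxes sit at `N = 2`).
* §2 `IsRecordOfRecord₈X F N D w` := `∃ θ c, θ.Admissible ∧ 0 < c ∧ θ.IsChartOfRecord c ∧` (the five clauses of `IsRecordOfRecord₈C` verbatim);
  `isRecordOfRecord₈C_of_isRecordOfRecord₈X` (hence ₇C, ₅C, ₀ by the landed refinements; `isRecordOfRecord₅C_of_isRecordOfRecord₈X`),
  `isRecordOfRecord₈X_of_eq` (pointed form), `exists_world_isRecordOfRecord₈X` (every admissible θ with a chart of record IS a ₈X record at a world with any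
  window `0 < γw ≤ θ.γ`), `exists_chart_of_isRecordOfRecord₈X` (the β of a ₈X record is `betaOfRecord₈ θ` at a θ whose chart is of record and, for `2 ≤ N`,
  non-zero).
* §3 THE GENUINE CHART AT `N = 2`: `pauliChart : (Fin 3 → ℝ) →L[ℝ] M₂(ℂ)`, `x ↦ X(x) = iΣ_a x_aσ_a` (r07's `B10Eq18SigmaSU2.su2Coord` as a continuous
  linear map; values in 𝔰𝔲(2) by `su2Coord_mem_su`, onto by `exists_su2Coord_eq`), `hsForm_su2Coord_single` (`Re Tr(X(e_a)ᴴX(e_b)) = 2δ_{ab}`),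
  `isSuChart_pauli` (`c = 2`), `Stage8Params.rechartPauli θ` (a Stage-8 parameter RE-CHARTED by `(ℝ³, pauliChart, standard basis)`; admissibility and box
  radius unchanged, `admissible_rechartPauli_iff` ∕ `rechartPauli_γ`), `isChartOfRecord_rechartPauli`, `betaOfRecord₈_rechartPauli` (the β of record at the
  Pauli chart, unfolded by `rfl` — the DISPLAYED non-degenerate chart instance), **`exists_isRecordOfRecord₈X_two`** ∕ `exists_isRecordOfRecord₈X_two_window`
  — INHABITED-AT-₈X for `N = 2` WITH PRINT'S OWN CHART (everything else as in the DEGENERATE ₈C inhabitant of `Record8Inhabited`: NOT objects of record).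
* §4 EVERY `N ≥ 1`: `exists_hsOrthonormal_family_suAlgebra` (𝔰𝔲(N) = `suAlgebra N` has an `hsForm`-ORTHONORMAL real basis, read as matrices: an orthogonal
  basis for the symmetric form `hsForm` restricted to it, `LinearMap.BilinForm.exists_orthogonal_basis`, rescaled by its positive-definite diagonal),
  `exists_isSuChart_one` (a chart of 𝔰𝔲(N) with `c = 1`: `ℝ^d` and its standard basis mapped onto that basis), `exists_admissible_stage8Params_chartOfRecord`
  (admissible Stage-8 parameters WITH a chart of record, any box radius), **`exists_isRecordOfRecord₈X`** ∕ `exists_isRecordOfRecord₈X_window` — INHABITED-AT-₈X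
  for EVERY four-torus family and EVERY `N ≥ 1` with a GENUINE chart (at `N = 1` that chart is the zero chart, §1).
HONEST FRAMING: definitions about the SHAPE of the record's β-chart + kernel bookkeeping; the constant `c`, the existence of the limits (1.21) and every
estimate stay DISPLAYED elsewhere; nothing of Bałaban's asserted; count-neutral; one finite T⁴ at fixed ε — NOT continuum ∕ ℝ⁴ ∕ OS ∕ mass gap ∕ Clay.
-/

noncomputable section

open MeasureTheory Filter
open scoped Matrix.Norms.L2Operator

namespace Literature.MathematicalPhysics.QuantumFieldTheory.Balaban1983to89.Node00

open FlowStep FlowStepRuns T4DatumAssembly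
open T4Continuum (T4Family FiniteEpsData)
open T4FiniteEpsInhabited (zeroHBeta)
open DagBinding (WorldP)
open Literature.Algebra.Lie.CompactKillingForm (hsForm hsForm_apply mem_su_iff hsForm_comm hsForm_apply_self_nonneg
  eq_zero_of_hsForm_apply_self_eq_zero)
open B10Eq18SigmaSU2 (su2Coord su2Coord_mem_su exists_su2Coord_eq)
open Matrix

variable (F : T4Family) (N : ℕ) [NeZero N]

/-! ## §1. The chart clause of record -/

section SuChart
omit [NeZero N]

/-- **A chart of 𝔰𝔲(N) with Hilbert–Schmidt-orthogonal basis of squared norm `c`** — on RAW chart data `(ρ, b)`: (i) every chart value `ρ v` is traceless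
skew-Hermitian (`CompactKillingForm.mem_su_iff`); (ii) every traceless skew-Hermitian matrix is a chart value; (iii) `Re Tr((ρ b_a)ᴴ(ρ b_a)) = c`;
(iv) `Re Tr((ρ b_a)ᴴ(ρ b_a')) = 0` for `a ≠ a'` (print's orthonormal colour components `B^a`; (1.21)₁ `Π^{ab} = δ^{ab}Π`).
[cite: Balaban1987RG1, p.264 (before (1.20)) and (1.21) p.264; Hall2015, Example 7.3 (𝔰𝔲(N))] -/
def IsSuChart {V : Type*} [NormedAddCommGroup V] [NormedSpace ℝ V] {ι : Type*} (ρ : V →L[ℝ] Matrix (Fin N) (Fin N) ℂ)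
    (b : Module.Basis ι ℝ V) (c : ℝ) : Prop :=
  (∀ v : V, (ρ v)ᴴ = -(ρ v) ∧ (ρ v).trace = 0) ∧
  (∀ X : Matrix (Fin N) (Fin N) ℂ, Xᴴ = -X → X.trace = 0 → ∃ v : V, ρ v = X) ∧
  (∀ a : ι, hsForm (Fin N) (ρ (b a)) (ρ (b a)) = c) ∧
  (∀ a a' : ι, a ≠ a' → hsForm (Fin N) (ρ (b a)) (ρ (b a')) = 0)

variable {N}

variable {V : Type*} [NormedAddCommGroup V] [NormedSpace ℝ V] {ι : Type*} {ρ : V →L[ℝ] Matrix (Fin N) (Fin N) ℂ}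
  {b : Module.Basis ι ℝ V} {c : ℝ}

/-- At a chart with `0 < c`, every basis vector has a NON-ZERO chart value (its Hilbert–Schmidt squared norm is `c`).
[cite: Balaban1987RG1, (1.21) p.264 (bookkeeping)] -/
theorem IsSuChart.apply_basis_ne_zero (h : IsSuChart N ρ b c) (hc : 0 < c) (a : ι) : ρ (b a) ≠ 0 := by
  intro h0
  have h1 := h.2.2.1 a
  rw [h0] at h1
  simp only [hsForm_apply, conjTranspose_zero, Matrix.zero_mul, trace_zero, Complex.zero_re] at h1
  exact absurd h1 (ne_of_lt hc)

/-- At a chart with `0 < c` and a non-empty basis index, the chart is NOT the zero map. [cite: Balaban1987RG1, (1.21) p.264 (bookkeeping)] -/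
theorem IsSuChart.ne_zero_of_nonempty (h : IsSuChart N ρ b c) (hc : 0 < c) (hι : Nonempty ι) : ρ ≠ 0 := by
  obtain ⟨a⟩ := hι
  intro h0
  apply h.apply_basis_ne_zero hc a
  rw [h0]
  rfl

/-- For `2 ≤ N`, 𝔰𝔲(N) ≠ 0: the matrix `diag(i, −i, 0, …, 0)` is traceless, skew-Hermitian and non-zero. [cite: Hall2015, Example 7.3] -/
theorem exists_tracelessSkewHermitian_ne_zero (hN : 2 ≤ N) :
    ∃ X : Matrix (Fin N) (Fin N) ℂ, Xᴴ = -X ∧ X.trace = 0 ∧ X ≠ 0 := by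
  have h0 : 0 < N := by omega
  have h1 : 1 < N := by omega
  let i₀ : Fin N := ⟨0, h0⟩
  let i₁ : Fin N := ⟨1, h1⟩
  have hne : i₀ ≠ i₁ := by
    intro h
    have := congrArg Fin.val h
    simp [i₀, i₁] at this
  refine ⟨diagonal (Pi.single i₀ Complex.I - Pi.single i₁ Complex.I), ?_, ?_, ?_⟩
  · rw [diagonal_conjTranspose, diagonal_neg]
    congr 1
    funext j
    simp only [Pi.star_apply, Pi.sub_apply, Pi.single_apply]
    split_ifs <;> simp [Complex.conj_I]
  · simp only [trace_diagonal, Pi.sub_apply, Finset.sum_sub_distrib, Finset.sum_pi_single', Finset.mem_univ, if_true,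
      sub_self]
  · intro h
    have := congrFun (congrFun h i₀) i₀
    simp [diagonal_apply_eq, hne] at this

/-- **For `2 ≤ N` a chart of 𝔰𝔲(N) has a non-empty basis** (its image is non-zero, so `V` is non-trivial). [cite: Hall2015, Example 7.3 (bookkeeping)] -/
theorem IsSuChart.nonempty_index_of_two_le (h : IsSuChart N ρ b c) (hN : 2 ≤ N) : Nonempty ι := by
  obtain ⟨X, hXh, hXt, hX0⟩ := exists_tracelessSkewHermitian_ne_zero (N := N) hN
  obtain ⟨v, hv⟩ := h.2.1 X hXh hXt
  have hv0 : v ≠ 0 := by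
    rintro rfl
    exact hX0 (by rw [← hv, map_zero])
  haveI : Nontrivial V := nontrivial_of_ne v 0 hv0
  exact b.index_nonempty

/-- **THE ZERO CHART IS EXCLUDED (`2 ≤ N`)**: a chart of 𝔰𝔲(N) with `0 < c` is not the zero map. [cite: Balaban1987RG1, (1.20)–(1.21) p.264 (bookkeeping)] -/
theorem IsSuChart.ne_zero_of_two_le (h : IsSuChart N ρ b c) (hc : 0 < c) (hN : 2 ≤ N) : ρ ≠ 0 :=
  h.ne_zero_of_nonempty hc (h.nonempty_index_of_two_le hN)

/-- 𝔰𝔲(1) = 0: a traceless `1 × 1` matrix is zero. [cite: Hall2015, Example 7.3] -/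
theorem eq_zero_of_traceless_one (X : Matrix (Fin 1) (Fin 1) ℂ) (hX : X.trace = 0) : X = 0 := by
  rw [trace_fin_one] at hX
  ext i j
  fin_cases i; fin_cases j
  simpa using hX

/-- At `N = 1` every chart of 𝔰𝔲(1) is the ZERO map. [cite: Hall2015, Example 7.3 (bookkeeping)] -/
theorem IsSuChart.eq_zero_of_one {ρ₁ : V →L[ℝ] Matrix (Fin 1) (Fin 1) ℂ} {b₁ : Module.Basis ι ℝ V} (h : IsSuChart 1 ρ₁ b₁ c) :
    ρ₁ = 0 := by
  ext1 v
  exact eq_zero_of_traceless_one _ (h.1 v).2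

end SuChart

variable {N}

/-- **THE CHART CLAUSE OF RECORD** for Stage-8 parameters `θ` with normalisation constant `c`: the β-layer's chart `(θ.Vβ, θ.ρ8, θ.bV)` is a chart of
𝔰𝔲(N) with `hsForm`-orthogonal basis of squared norm `c` (`IsSuChart`). [cite: Balaban1987RG1, (1.20)–(1.21) p.264] -/
def Stage8Params.IsChartOfRecord {F : T4Family} (θ : Stage8Params F N) (c : ℝ) : Prop :=
  letI := θ.instVβ₁; letI := θ.instVβ₂; IsSuChart N θ.ρ8 θ.bV c

variable {F}

/-- **THE ZERO CHART IS EXCLUDED at a chart of record (`2 ≤ N`, `0 < c`)** — so `Record8Inhabited.betaOfRecord₈_of_zeroChart` cannot fire: the β of record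
reads Bałaban's Hessian on 𝔰𝔲(N). [cite: Balaban1987RG1, (1.20)–(1.21) p.264 (bookkeeping)] -/
theorem Stage8Params.IsChartOfRecord.rho8_ne_zero {θ : Stage8Params F N} {c : ℝ} (h : θ.IsChartOfRecord c) (hc : 0 < c) (hN : 2 ≤ N) :
    (letI := θ.instVβ₁; letI := θ.instVβ₂; θ.ρ8) ≠ 0 := by
  letI := θ.instVβ₁; letI := θ.instVβ₂
  exact IsSuChart.ne_zero_of_two_le h hc hN

/-- For `2 ≤ N` a chart of record has a non-empty basis index. [cite: Hall2015, Example 7.3 (bookkeeping)] -/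
theorem Stage8Params.IsChartOfRecord.nonempty_index {θ : Stage8Params F N} {c : ℝ} (h : θ.IsChartOfRecord c) (hN : 2 ≤ N) :
    Nonempty θ.ιβ := by
  letI := θ.instVβ₁; letI := θ.instVβ₂
  exact IsSuChart.nonempty_index_of_two_le h hN

/-- **At `N = 1` the chart of record IS the zero chart** (𝔰𝔲(1) = 0). [cite: Hall2015, Example 7.3; Balaban1987RG1, (1.20) p.264 (bookkeeping)] -/
theorem Stage8Params.IsChartOfRecord.rho8_eq_zero_of_one {θ : Stage8Params F 1} {c : ℝ} (h : θ.IsChartOfRecord c) :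
    (letI := θ.instVβ₁; letI := θ.instVβ₂; θ.ρ8) = 0 := by
  letI := θ.instVβ₁; letI := θ.instVβ₂
  exact IsSuChart.eq_zero_of_one h

/-- **… hence at `N = 1` the Stage-8 β of record vanishes identically at EVERY chart of record** — genuinely: 𝔰𝔲(1) = 0; any Thm-2 ∕ (0.31) clause
over the record predicate needs `2 ≤ N`. [cite: Balaban1987RG1, Thm 2 (0.31) p.259 and (1.20)–(1.22) p.264 (bookkeeping at N = 1)] -/
theorem Stage8Params.IsChartOfRecord.betaOfRecord₈_eq_zeroHBeta_of_one {θ : Stage8Params F 1} {c : ℝ} (h : θ.IsChartOfRecord c) :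
    betaOfRecord₈ F 1 θ = zeroHBeta :=
  Record8Inhabited.betaOfRecord₈_of_zeroChart F 1 θ h.rho8_eq_zero_of_one

/-! ## §2. The amended record predicate `IsRecordOfRecord₈X` -/

variable (F N)

/-- **«(D, w) is the record, Stage 8, WITH THE CHART OF RECORD»**: `IsRecordOfRecord₈C` whose witnessing parameter moreover carries the chart clause of
record with a positive normalisation constant.  (The Stage-9 owner may take this conjunct into `Record9.Admissible` verbatim.)
[cite: Balaban1987RG1, (0.17)–(0.22) pp.255–256 and (1.20)–(1.22) p.264; Balaban1989LargeFieldII, Thm 1 p.355 (objects of record, Stage 8 + chart dictionary)] -/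
def IsRecordOfRecord₈X (D : FiniteEpsData F (SU N)) (w : WorldP) : Prop :=
  ∃ (θ : Stage8Params F N) (c : ℝ), θ.Admissible ∧ 0 < c ∧ θ.IsChartOfRecord c ∧
    D = datumOfRecord₅ F N (θ.toStage5 F N) ∧ w.C = D.C ∧ (0 < w.γ ∧ w.γ ≤ θ.γ) ∧ w.L = (θ.L : ℝ) ∧
    ∀ P : B12.RunParams, w.up P = upOfRecord₅C F N (θ.toStage5 F N) P

variable {F N}

/-- **Refinement `IsRecordOfRecord₈X → IsRecordOfRecord₈C`** (forget the chart clause) — hence → ₇C → ₅C → ₀ by the landed refinements.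
[cite: Balaban1987RG1, (0.22) p.256 (bookkeeping)] -/
theorem isRecordOfRecord₈C_of_isRecordOfRecord₈X {D : FiniteEpsData F (SU N)} {w : WorldP} (h : IsRecordOfRecord₈X F N D w) :
    IsRecordOfRecord₈C F N D w := by
  obtain ⟨θ, c, hθ, -, -, hD, hC, hγ, hL, hup⟩ := h
  exact ⟨θ, hθ, hD, hC, hγ, hL, hup⟩

/-- Down to the record predicate of record ₅C. [cite: Balaban1989LargeFieldI, (0.2) p.176 (bookkeeping)] -/
theorem isRecordOfRecord₅C_of_isRecordOfRecord₈X {D : FiniteEpsData F (SU N)} {w : WorldP} (h : IsRecordOfRecord₈X F N D w) :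
    IsRecordOfRecord₅C F N D w :=
  isRecordOfRecord₅C_of_isRecordOfRecord₈C (isRecordOfRecord₈C_of_isRecordOfRecord₈X h)

variable (F N)

/-- **Pointed form**: admissible Stage-8 parameters carrying the chart of record, with a world bound to their construction, a window `0 < w.γ ≤ θ.γ`,
`θ.L` and the upstream block of record, form a ₈X record. [cite: Balaban1989LargeFieldII, Thm 1 + (0.1) pp.355–356 (bookkeeping)] -/
theorem isRecordOfRecord₈X_of_eq (θ : Stage8Params F N) (hθ : θ.Admissible) {c : ℝ} (hc : 0 < c) (hch : θ.IsChartOfRecord c) (w : WorldP)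
    (hC : w.C = (datumOfRecord₅ F N (θ.toStage5 F N)).C) (hγ : 0 < w.γ ∧ w.γ ≤ θ.γ) (hL : w.L = (θ.L : ℝ))
    (hup : ∀ P, w.up P = upOfRecord₅C F N (θ.toStage5 F N) P) :
    IsRecordOfRecord₈X F N (datumOfRecord₅ F N (θ.toStage5 F N)) w :=
  ⟨θ, c, hθ, hc, hch, rfl, hC, hγ, hL, hup⟩

/-- **Every admissible Stage-8 parameter with a chart of record IS a ₈X record at some world**, with any window `0 < γw ≤ θ.γ`.
[cite: Balaban1989LargeFieldII, Thm 1 + (0.1) pp.355–356 (bookkeeping)] -/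
theorem exists_world_isRecordOfRecord₈X (θ : Stage8Params F N) (hθ : θ.Admissible) {c : ℝ} (hc : 0 < c) (hch : θ.IsChartOfRecord c)
    {γw : ℝ} (hγw : 0 < γw ∧ γw ≤ θ.γ) :
    ∃ w : WorldP, IsRecordOfRecord₈X F N (datumOfRecord₅ F N (θ.toStage5 F N)) w ∧ w.γ = γw := by
  obtain ⟨w₀⟩ := nonempty_worldP
  exact ⟨{ w₀ with
      C := (datumOfRecord₅ F N (θ.toStage5 F N)).C, γ := γw, L := (θ.L : ℝ), one_lt_L := by exact_mod_cast θ.hL.2,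
      up := fun P => upOfRecord₅C F N (θ.toStage5 F N) P },
    ⟨θ, c, hθ, hc, hch, rfl, rfl, hγw, rfl, fun _ => rfl⟩, rfl⟩

variable {F N}

/-- **What a ₈X record's β IS**: `betaOfRecord₈ θ` at admissible parameters whose chart is of record — and, for `2 ≤ N`, NON-ZERO (the zero-chart junk of
`Record8Inhabited` is not a ₈X witness). [cite: Balaban1987RG1, (1.20)–(1.22) p.264 (bookkeeping)] -/
theorem exists_chart_of_isRecordOfRecord₈X {D : FiniteEpsData F (SU N)} {w : WorldP} (h : IsRecordOfRecord₈X F N D w) (hN : 2 ≤ N) :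
    ∃ (θ : Stage8Params F N) (c : ℝ), θ.Admissible ∧ 0 < c ∧ θ.IsChartOfRecord c ∧ D = datumOfRecord₅ F N (θ.toStage5 F N) ∧
      D.βfun = betaOfRecord₈ F N θ ∧ (letI := θ.instVβ₁; letI := θ.instVβ₂; θ.ρ8) ≠ 0 ∧ 0 < w.γ ∧ w.γ ≤ θ.γ := by
  obtain ⟨θ, c, hθ, hc, hch, hD, -, ⟨hγ0, hγle⟩, -, -⟩ := h
  subst hD
  exact ⟨θ, c, hθ, hc, hch, rfl, βfun_stage8 F N θ, hch.rho8_ne_zero hc hN, hγ0, hγle⟩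

/-! ## §3. The genuine chart at `N = 2`: print's Pauli coordinates -/

/-- **Print's coordinate chart of 𝔰𝔲(2)** as a continuous linear map `ℝ³ → M₂(ℂ)`: `x ↦ X(x) = i Σ_a x_a σ_a` (r07's `B10Eq18SigmaSU2.su2Coord`; cf.
`B13HaarSigmaJacobian.su2Coordₗ`, the same map valued in the subtype). [cite: Balaban1985UV3, p.260 («A = Σ σ_aA^a»); Balaban1987RG1, p.264 (before (1.20))] -/
def pauliChart : (Fin 3 → ℝ) →L[ℝ] Matrix (Fin 2) (Fin 2) ℂ :=
  LinearMap.toContinuousLinearMap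
    { toFun := su2Coord
      map_add' := fun x y => by
        ext i j
        fin_cases i <;> fin_cases j <;> simp [su2Coord, Complex.ofReal_add] <;> ring
      map_smul' := fun r x => by
        ext i j
        fin_cases i <;> fin_cases j <;> simp [su2Coord, Complex.real_smul, Complex.ofReal_mul] <;> ring }

/-- `pauliChart x = X(x)`. [cite: Balaban1985UV3, p.260] -/
@[simp] theorem pauliChart_apply (x : Fin 3 → ℝ) : pauliChart x = su2Coord x := rfl

/-- **The Pauli basis is Hilbert–Schmidt-orthogonal with squared norms `2`**: `Re Tr(X(e_a)ᴴ X(e_b)) = Re Tr(σ_aσ_b) = 2δ_{ab}`.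
[cite: Balaban1985UV3, p.260; Hall2015, Example 7.3] -/
theorem hsForm_su2Coord_single (a b : Fin 3) :
    hsForm (Fin 2) (su2Coord (Pi.single a 1)) (su2Coord (Pi.single b 1)) = if a = b then 2 else 0 := by
  fin_cases a <;> fin_cases b <;>
    simp [su2Coord, trace_fin_two, conjTranspose, mul_apply, Fin.sum_univ_two] <;> norm_num

/-- **The Pauli chart with the standard basis of `ℝ³` IS a chart of 𝔰𝔲(2) with `c = 2`**: values in 𝔰𝔲(2) (`su2Coord_mem_su`), onto (`exists_su2Coord_eq`),
orthogonal (`hsForm_su2Coord_single`). [cite: Balaban1987RG1, (1.20)–(1.21) p.264; Balaban1985UV3, p.260] -/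
theorem isSuChart_pauli : IsSuChart 2 pauliChart (Pi.basisFun ℝ (Fin 3)) 2 := by
  refine ⟨fun v => ?_, fun X hXh hXt => ?_, fun a => ?_, fun a a' haa => ?_⟩
  · rw [pauliChart_apply]
    exact mem_su_iff.mp (su2Coord_mem_su v)
  · obtain ⟨x, hx⟩ := exists_su2Coord_eq (mem_su_iff.mpr ⟨hXh, hXt⟩)
    exact ⟨x, by rw [pauliChart_apply, hx]⟩
  · rw [Pi.basisFun_apply, pauliChart_apply, hsForm_su2Coord_single, if_pos rfl]
  · rw [Pi.basisFun_apply, Pi.basisFun_apply, pauliChart_apply, pauliChart_apply, hsForm_su2Coord_single, if_neg haa]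

/-- **A Stage-8 parameter RE-CHARTED by the Pauli chart** (`N = 2`): same Stage-7 parameters, `εbg` and base histories `v₀`; `Vβ := ℝ³`, `ρ8 := pauliChart`,
`bV :=` the standard basis (so `ρ8 (bV a) = X(e_a) = iσ_a`). [cite: Balaban1987RG1, (1.20)–(1.21) p.264; Balaban1985UV3, p.260] -/
def Stage8Params.rechartPauli (θ : Stage8Params F 2) : Stage8Params F 2 where
  toStage7Params := θ.toStage7Params
  εbg := θ.εbg
  Vβ := Fin 3 → ℝ
  ιβ := Fin 3
  ρ8 := pauliChart
  bV := Pi.basisFun ℝ (Fin 3)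
  v₀ := θ.v₀

/-- Re-charting preserves admissibility (admissibility reads the Stage-7 parameters and `εbg` only; `Iff.rfl`). [cite: Balaban1987RG1, (0.21) p.256 (bookkeeping)] -/
theorem Stage8Params.admissible_rechartPauli_iff (θ : Stage8Params F 2) : θ.rechartPauli.Admissible ↔ θ.Admissible := Iff.rfl

/-- The re-charted parameter has the same box radius (`rfl`). [cite: Balaban1989LargeFieldII, Thm 1 p.355 (bookkeeping)] -/
theorem Stage8Params.rechartPauli_γ (θ : Stage8Params F 2) : θ.rechartPauli.γ = θ.γ := rfl

/-- **The re-charted parameter carries THE CHART OF RECORD with `c = 2`** (`isSuChart_pauli`). [cite: Balaban1987RG1, (1.20)–(1.21) p.264] -/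
theorem Stage8Params.isChartOfRecord_rechartPauli (θ : Stage8Params F 2) : θ.rechartPauli.IsChartOfRecord 2 :=
  isSuChart_pauli

/-- **The β of record at the Pauli chart, unfolded** (`rfl`): the Stage-8 β-functions of the re-charted parameter read Bałaban's merged term through
`pauliChart` and the standard basis — the DISPLAYED non-degenerate chart instance a NODE-O (D4) instance claim must name.
[cite: Balaban1987RG1, (1.20)–(1.22) p.264 (bookkeeping)] -/
theorem betaOfRecord₈_rechartPauli (θ : Stage8Params F 2) :
    betaOfRecord₈ F 2 θ.rechartPauli =
      betaOfMerged (betaMerged F (mergedTermFamilyMat F 2 (chi7 F 2 θ.rechartPauli) θ.εbg) pauliChart (Pi.basisFun ℝ (Fin 3)))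
        (beta0OfMerged (betaMerged F (mergedTermFamilyMat F 2 (chi7 F 2 θ.rechartPauli) θ.εbg) pauliChart (Pi.basisFun ℝ (Fin 3))) θ.v₀)
        θ.γ := rfl

variable (F)

/-- **INHABITED-AT-₈X, `N = 2`, WITH THE GENUINE CHART**, any box radius `γ` and window `0 < γw ≤ γ`: a Stage-8 record `(D, w)` at `SU(2)` whose witnessing
parameter carries print's Pauli chart of 𝔰𝔲(2) (`c = 2`) — every other object as in the DEGENERATE inhabitant of `Record8Inhabited` (NOT objects of record;
nothing of Bałaban's asserted). [cite: Balaban1987RG1, (0.17)–(0.22) pp.255–256 and (1.20)–(1.22) p.264; Balaban1985UV3, p.260; Balaban1989LargeFieldII, Thm 1 p.355 (bookkeeping witness)] -/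
theorem exists_isRecordOfRecord₈X_two_window {γ γw : ℝ} (h0 : 0 < γw) (hle : γw ≤ γ) :
    ∃ (D : FiniteEpsData F (SU 2)) (w : WorldP), IsRecordOfRecord₈X F 2 D w ∧ w.γ = γw := by
  obtain ⟨θ, hθ, -, hγ, -⟩ := Record8Inhabited.exists_admissible_stage8Params_zeroChart F 2 γ (h0.trans_le hle)
  obtain ⟨w, hw, hwγ⟩ := exists_world_isRecordOfRecord₈X F 2 θ.rechartPauli (θ.admissible_rechartPauli_iff.mpr hθ) two_pos
    θ.isChartOfRecord_rechartPauli (γw := γw) ⟨h0, by rw [Stage8Params.rechartPauli_γ, hγ]; exact hle⟩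
  exact ⟨_, w, hw, hwγ⟩

/-- **INHABITED-AT-₈X, `N = 2`** (plain form). [cite: Balaban1987RG1, (1.20)–(1.22) p.264 (bookkeeping witness)] -/
theorem exists_isRecordOfRecord₈X_two : ∃ (D : FiniteEpsData F (SU 2)) (w : WorldP), IsRecordOfRecord₈X F 2 D w := by
  obtain ⟨D, w, h, -⟩ := exists_isRecordOfRecord₈X_two_window F (γ := 1) (γw := 1) one_pos le_rfl
  exact ⟨D, w, h⟩

/-! ## §4. A chart of record EXISTS for every `N` (Gram–Schmidt for the Hilbert–Schmidt form on 𝔰𝔲(N)) -/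

section GramSchmidt
omit [NeZero N]

/-- **𝔰𝔲(N) has a Hilbert–Schmidt-ORTHONORMAL real basis**, read as a family of matrices: there are `d` traceless skew-Hermitian matrices `G_a`, pairwise
`hsForm`-orthogonal with squared norms `1`, spanning 𝔰𝔲(N) over `ℝ` (`suAlgebra N` = `skewAdjoint ⊓ ker Tr`; an orthogonal basis for the symmetric form
`hsForm` restricted to it — `LinearMap.BilinForm.exists_orthogonal_basis` — rescaled by the positive-definite diagonal). [cite: Hall2015, Example 7.3 and Exercise 7.3] -/
theorem exists_hsOrthonormal_family_suAlgebra :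
    ∃ (d : ℕ) (G : Fin d → Matrix (Fin N) (Fin N) ℂ), (∀ a, G a ∈ suAlgebra N) ∧
      (∀ X ∈ suAlgebra N, ∃ x : Fin d → ℝ, ∑ a, x a • G a = X) ∧
      (∀ a, hsForm (Fin N) (G a) (G a) = 1) ∧ (∀ a a', a ≠ a' → hsForm (Fin N) (G a) (G a') = 0) := by
  classical
  set W : Submodule ℝ (Matrix (Fin N) (Fin N) ℂ) := suAlgebra N with hW
  let B : LinearMap.BilinForm ℝ W := (hsForm (Fin N)).restrict W
  have hB : B.IsSymm := ⟨fun x y => by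
    simp only [B, LinearMap.BilinForm.restrict_apply]
    exact hsForm_comm _ _⟩
  haveI : Invertible (2 : ℝ) := invertibleOfNonzero two_ne_zero
  obtain ⟨v, hv⟩ := LinearMap.BilinForm.exists_orthogonal_basis (LinearMap.BilinForm.isSymm_iff.mp hB)
  -- the diagonal is positive (hsForm is positive definite; basis vectors are non-zero)
  have hq : ∀ a, 0 < hsForm (Fin N) (v a : Matrix (Fin N) (Fin N) ℂ) (v a) := fun a => by
    rcases (hsForm_apply_self_nonneg (v a : Matrix (Fin N) (Fin N) ℂ)).lt_or_eq with h | h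
    · exact h
    · exact absurd ((Submodule.coe_eq_zero).mp (eq_zero_of_hsForm_apply_self_eq_zero h.symm)) (v.ne_zero a)
  let r : Fin (Module.finrank ℝ W) → ℝ := fun a => Real.sqrt (hsForm (Fin N) (v a : Matrix (Fin N) (Fin N) ℂ) (v a))
  have hr : ∀ a, 0 < r a := fun a => Real.sqrt_pos.mpr (hq a)
  have hrr : ∀ a, r a * r a = hsForm (Fin N) (v a : Matrix (Fin N) (Fin N) ℂ) (v a) := fun a => Real.mul_self_sqrt (hq a).le
  refine ⟨Module.finrank ℝ W, fun a => (r a)⁻¹ • (v a : Matrix (Fin N) (Fin N) ℂ), fun a => W.smul_mem _ (v a).2, ?_, ?_, ?_⟩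
  · intro X hX
    refine ⟨fun a => v.repr ⟨X, hX⟩ a * r a, ?_⟩
    have hsum := congrArg Subtype.val (v.sum_repr ⟨X, hX⟩)
    rw [Submodule.coe_sum] at hsum
    simp only [Submodule.coe_smul] at hsum
    refine Eq.trans (Finset.sum_congr rfl fun a _ => ?_) hsum
    show (v.repr ⟨X, hX⟩ a * r a) • ((r a)⁻¹ • (v a : Matrix (Fin N) (Fin N) ℂ)) = v.repr ⟨X, hX⟩ a • (v a : Matrix (Fin N) (Fin N) ℂ)
    rw [smul_smul, mul_assoc, mul_inv_cancel₀ (hr a).ne', mul_one]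
  · intro a
    have hra : r a ≠ 0 := (hr a).ne'
    show hsForm (Fin N) ((r a)⁻¹ • (v a : Matrix (Fin N) (Fin N) ℂ)) ((r a)⁻¹ • (v a : Matrix (Fin N) (Fin N) ℂ)) = 1
    rw [LinearMap.map_smul₂, map_smul, smul_eq_mul, smul_eq_mul, ← hrr a]
    field_simp
  · intro a a' haa
    have h0 : B (v a) (v a') = 0 := LinearMap.isOrthoᵢ_def.mp hv a a' haa
    simp only [B, LinearMap.BilinForm.restrict_apply, LinearMap.domRestrict_apply] at h0
    show hsForm (Fin N) ((r a)⁻¹ • (v a : Matrix (Fin N) (Fin N) ℂ)) ((r a')⁻¹ • (v a' : Matrix (Fin N) (Fin N) ℂ)) = 0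
    rw [LinearMap.map_smul₂, map_smul, smul_eq_mul, smul_eq_mul, h0, mul_zero, mul_zero]

/-- **A CHART OF RECORD EXISTS FOR EVERY `N`, with `c = 1`**: `ℝ^d` with its standard basis, mapped onto an `hsForm`-orthonormal basis of 𝔰𝔲(N)
(`exists_hsOrthonormal_family_suAlgebra`). [cite: Balaban1987RG1, (1.20)–(1.21) p.264; Hall2015, Example 7.3] -/
theorem exists_isSuChart_one :
    ∃ (d : ℕ) (ρ : (Fin d → ℝ) →L[ℝ] Matrix (Fin N) (Fin N) ℂ), IsSuChart N ρ (Pi.basisFun ℝ (Fin d)) 1 := by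
  classical
  obtain ⟨d, G, hmem, hspan, hone, horth⟩ := exists_hsOrthonormal_family_suAlgebra (N := N)
  refine ⟨d, LinearMap.toContinuousLinearMap (Fintype.linearCombination ℝ G), fun x => ?_, fun X hXh hXt => ?_, fun a => ?_,
    fun a a' haa => ?_⟩
  · have hx : Fintype.linearCombination ℝ G x ∈ suAlgebra N := by
      rw [Fintype.linearCombination_apply]
      exact Submodule.sum_mem _ fun a _ => Submodule.smul_mem _ _ (hmem a)
    exact (mem_suAlgebra_iff _).mp hx
  · obtain ⟨x, hx⟩ := hspan X ((mem_suAlgebra_iff X).mpr ⟨hXh, hXt⟩)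
    exact ⟨x, by rw [LinearMap.coe_toContinuousLinearMap', Fintype.linearCombination_apply, hx]⟩
  · rw [Pi.basisFun_apply, LinearMap.coe_toContinuousLinearMap', Fintype.linearCombination_apply_single, one_smul]
    exact hone a
  · rw [Pi.basisFun_apply, Pi.basisFun_apply, LinearMap.coe_toContinuousLinearMap', Fintype.linearCombination_apply_single,
      Fintype.linearCombination_apply_single, one_smul, one_smul]
    exact horth a a' haa

end GramSchmidt

variable (N)

/-- **Admissible Stage-8 parameters WITH A CHART OF RECORD (`c = 1`) exist for every `N ≥ 1`**, with `D = 4` and any box radius `γ > 0` (the zero-chart witness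
of `Record8Inhabited` RE-CHARTED by `exists_isSuChart_one`). [cite: Balaban1987RG1, (0.21) p.256 and (1.20)–(1.22) p.264 (parameter dictionary; bookkeeping witness)] -/
theorem exists_admissible_stage8Params_chartOfRecord (γ : ℝ) (hγ : 0 < γ) :
    ∃ θ : Stage8Params F N, θ.Admissible ∧ θ.D = 4 ∧ θ.γ = γ ∧ θ.IsChartOfRecord 1 := by
  obtain ⟨θ, hθ, hD, hγ', -⟩ := Record8Inhabited.exists_admissible_stage8Params_zeroChart F N γ hγ
  obtain ⟨d, ρ, hρ⟩ := exists_isSuChart_one (N := N)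
  exact ⟨{ toStage7Params := θ.toStage7Params, εbg := θ.εbg, Vβ := Fin d → ℝ, ιβ := Fin d, ρ8 := ρ, bV := Pi.basisFun ℝ (Fin d),
           v₀ := θ.v₀ }, hθ, hD, hγ', hρ⟩

/-- **INHABITED-AT-₈X FOR EVERY `N ≥ 1`, any box radius `γ` and window `0 < γw ≤ γ`, WITH A GENUINE CHART** (`c = 1`; every other object DEGENERATE as in
`Record8Inhabited` — NOT objects of record; nothing of Bałaban's asserted). [cite: Balaban1987RG1, (0.17)–(0.22) pp.255–256 and (1.20)–(1.22) p.264; Balaban1989LargeFieldII, Thm 1 p.355 (bookkeeping witness)] -/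
theorem exists_isRecordOfRecord₈X_window {γ γw : ℝ} (h0 : 0 < γw) (hle : γw ≤ γ) :
    ∃ (D : FiniteEpsData F (SU N)) (w : WorldP), IsRecordOfRecord₈X F N D w ∧ w.γ = γw := by
  obtain ⟨θ, hθ, -, hγ, hch⟩ := exists_admissible_stage8Params_chartOfRecord F N γ (h0.trans_le hle)
  obtain ⟨w, hw, hwγ⟩ := exists_world_isRecordOfRecord₈X F N θ hθ one_pos hch (γw := γw) ⟨h0, by rw [hγ]; exact hle⟩
  exact ⟨_, w, hw, hwγ⟩

/-- **INHABITED-AT-₈X, every `N ≥ 1`** (plain form). [cite: Balaban1987RG1, (1.20)–(1.22) p.264 (bookkeeping witness)] -/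
theorem exists_isRecordOfRecord₈X : ∃ (D : FiniteEpsData F (SU N)) (w : WorldP), IsRecordOfRecord₈X F N D w := by
  obtain ⟨D, w, h, -⟩ := exists_isRecordOfRecord₈X_window F N (γ := 1) (γw := 1) one_pos le_rfl
  exact ⟨D, w, h⟩

end Literature.MathematicalPhysics.QuantumFieldTheory.Balaban1983to89.Node00

end
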